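import Summits.QuantumFields.BalabanUV.Beta.EriceFlowEnclosureB12AsPrintedPointwiseFadingOrderSharpWitness
import Summits.QuantumFields.BalabanUV.Beta.EriceFlowEnclosureB12AsPrintedHistoryNonuniqueForward

/-!
# Beta / EriceFlowEnclosureB12AsPrintedPointwiseFadingOrderSharpWitnessEnd — WHAT (0.31) FORCES POINTWISE, part 7♯ END: **THE CONSTANT 2(1 − √θ)² IS SHARP FOR
# ORDER.**  `…Sharp.order_preserved_sqrt` (gen 45): under node U2's coupling-chart moduli `HistLipschitz Λ γ β` + `FadingMemory C θ Λ` (0 < θ < 1) two same-length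
# runs of (0.20) in a box ]0, γ] with **Cγ³ ≤ 2(1 − √θ)²** keep the order of their bare couplings at every scale — sign-free, AF-free.  HERE: for every 0 < θ < 1
# and EVERY c > 2(1 − √θ)² there are C, γ with **Cγ³ ≤ c**, moduli Λ k i = Cθ^{k−i} (so `FadingMemory C θ Λ`), a history-dependent β with `HistLipschitz Λ γ β` (the
# CLAMP FAMILY of `…SharpWitness`, a toy of ours), a depth K and two runs of (0.20) of length K inside ]0, γ] — the constant run g′ ≡ 1 and a run g started
# just BELOW 1 — with g_0 < g′_0 and g_j ≥ g′_j at some scale j ≤ K (**`order_reversal_above_edge`**): the hypothesis `Cγ³ ≤ 2(1 − √θ)²` of `order_preserved_sqrt`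
# cannot be replaced by `Cγ³ ≤ c` for any larger c.  So for ORDER under fading memory the sharp box is EXACTLY Cγ³ = 2(1 − √θ)² — prover 1's conjectured
# asymptotics for the reference-free threshold (bflow-p1 gen 35 NEXT (A)) is the exact value, for order; for UNIQUENESS it is the edge of both comparison
# methods (`…SharpOscillation` §1) and a lower bound, prover 1's folds (#63d Markov Cγ³ = 6; #63f memory fold θ = ½, Cγ³ = 3∕2) being the data from above.
# MECHANISM: constants C := (1−√θ)² + c∕2, τ := min(¼, (c − 2(1−√θ)²)∕(8C)), γ := 1 + τ (`constants_exist`: Cγ³ ≤ c and c₋ := C(1−τ)²∕(2+τ) > (1−√θ)², so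
# p := 1 + θ − c₋ < 2√θ); depth N = n + 1 with n ≥ p²∕(θ − p²∕4) + 1 (`…SharpOscillation.oscillation_fin`); growth factor M := 1 + 2C∕(1−θ) and start 1∕g_0² = 1 + δ₀,
# δ₀ := τ∕(2M^N): the forward solution exists, stays positive and satisfies |1∕g_i² − 1| ≤ M^iδ₀ ≤ τ∕2 up to depth N (**`clampRun`**, joint induction using
# `…SharpWitness.beta_prefix_abs_le` and the forward table `…HistoryNonuniqueForward.fwd_d020`), hence stays in the band where (0.20) IS the adversarial
# recursion (`band_twoTerm`), which cannot stay positive for N steps: some 1∕g_j² ≤ 1, i.e. g_j ≥ 1 = g′_j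
# (β-flow team, prover 2 = lower ∕ positivity side, unit `b2b-balaban-beta-bflow-p2`, gen 45; ROW AP-I × node U2's letters; a TOY FAMILY of ours)

HONEST FRAMING (page 1 of everything the β sub-cell writes): discharging `BetaPertH` makes Bałaban's UV stability UNCONDITIONAL — a
real constructive-QFT result; it is NOT the continuum limit and NOT the Clay problem.  HONEST DEPENDENCY (cell reorg 2026-08-19,
verbatim): «continuum YM on T⁴ ⇐ BetaPertH ∧ nine spine estimates (0/9 proved); BetaPertH ⇐ (D1) ∧ (D4) ∧ CAP+tail; G-an2-4 gates
asym, D1 and NE2/3/4.»  THIS MODULE DISCHARGES NOTHING: it is elementary real analysis about an EXPLICIT TOY family (ours — NOT Bałaban's β of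
[I] = T. Bałaban, Commun. Math. Phys. **109** (1987) [Balaban1987RG1] (1.22) p. 264) and the forward solutions of the recursion (0.20) p. 256 for it; the
moduli it inhabits are node U2's UNPRINTED hypothesis shapes (GAPS G-t4-U2-2; p. 298).  It says NOTHING about whether Bałaban's β has fading memory, nor
about Theorem 2 (an existence statement, p. 259, STATED WITHOUT PROOF; uniqueness ∕ order of g₀ are not printed — custodian's DELTA-I D-21).

WHAT THIS FILE PROVES (0 sorry, 0 def): `constants_exist`, `depth_exists`, **`clampRun`**, **`order_reversal_above_edge`**.
NOT CLAIMED: the sharp constant for UNIQUENESS among all families (open between 2(1−√θ)² and prover 1's folds); anything about Bałaban's β; Theorem 2;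
`BetaPertH`; continuum; Clay.
-/

namespace Summit.QuantumFields.BalabanUV.Beta.EriceFlowEnclosureB12AsPrintedPointwiseFadingOrderSharpWitnessEnd

open Finset
open Literature.MathematicalPhysics.QuantumFieldTheory.Balaban1983to89
open Literature.MathematicalPhysics.QuantumFieldTheory.Balaban1983to89.FlowStep (HBeta prefixOf Box mem_box RGEqH)
open Literature.MathematicalPhysics.QuantumFieldTheory.Balaban1983to89.T4CouplingMatching (HistLipschitz FadingMemory)
open Summit.QuantumFields.BalabanUV.Beta.EriceFlowEnclosureB12AsPrintedHistoryNonuniqueForward (fwd_d020)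
open Summit.QuantumFields.BalabanUV.Beta.EriceFlowEnclosureB12AsPrintedPointwiseFadingOrderSharpOscillation (oscillation_fin)
open Summit.QuantumFields.BalabanUV.Beta.EriceFlowEnclosureB12AsPrintedPointwiseFadingOrderSharpWitness

noncomputable section

/-- **THE CONSTANTS.**  For 0 ≤ θ < 1 and c > 2(1 − √θ)²: C := (1−√θ)² + c∕2 and τ := min(¼, (c − 2(1−√θ)²)∕(8C)) satisfy C > 0, 0 < τ ≤ ¼, **C(1 + τ)³ ≤ c** (the box
γ = 1 + τ has Cγ³ ≤ c) and **(1 − √θ)² < C(1 − τ)²∕(2 + τ)** (the smallest band coefficient is above the edge). [folklore] -/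
theorem constants_exist {θ c : ℝ} (hc : 2 * (1 - Real.sqrt θ) ^ 2 < c) :
    ∃ C τ : ℝ, 0 < C ∧ 0 < τ ∧ τ ≤ 1 / 4 ∧ C * (1 + τ) ^ 3 ≤ c ∧
      (1 - Real.sqrt θ) ^ 2 < C * ((1 - τ) ^ 2 / (2 + τ)) := by
  set e : ℝ := (1 - Real.sqrt θ) ^ 2 with he
  have he0 : 0 ≤ e := sq_nonneg _
  set g₀ : ℝ := c - 2 * e with hg₀
  have hg₀0 : 0 < g₀ := by rw [hg₀]; linarith
  set C : ℝ := e + c / 2 with hC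
  have hCpos : 0 < C := by rw [hC]; linarith
  have heC : e ≤ C := by rw [hC]; linarith
  set τ : ℝ := min (1 / 4) (g₀ / (8 * C)) with hτ
  have hτ0 : 0 < τ := lt_min (by norm_num) (by positivity)
  have hτ4 : τ ≤ 1 / 4 := min_le_left _ _
  have hτg : τ ≤ g₀ / (8 * C) := min_le_right _ _
  have hτC : τ * C ≤ g₀ / 8 := by
    have h := mul_le_mul_of_nonneg_right hτg hCpos.le
    rwa [div_mul_eq_mul_div, mul_div_mul_right _ _ hCpos.ne'] at h
  refine ⟨C, τ, hCpos, hτ0, hτ4, ?_, ?_⟩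
  · have h34 : 3 * τ + τ ^ 2 ≤ 1 := by nlinarith
    have hCτ0 : 0 ≤ C * τ := by positivity
    nlinarith [mul_le_mul_of_nonneg_left h34 hCτ0, hτC]
  · rw [← mul_div_assoc, lt_div_iff₀ (by linarith : (0 : ℝ) < 2 + τ)]
    nlinarith [mul_le_mul_of_nonneg_right heC hτ0.le, hτC, mul_nonneg hCpos.le (sq_nonneg τ)]

/-- A natural number above 1 and above a prescribed real. [folklore] -/
theorem depth_exists (x : ℝ) : ∃ n : ℕ, 1 ≤ n ∧ x ≤ n :=
  ⟨max 1 ⌈x⌉₊, le_max_left _ _, (Nat.le_ceil x).trans (by exact_mod_cast le_max_right 1 ⌈x⌉₊)⟩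

/-- **THE RUN STARTED JUST BELOW 1 EXISTS AND STAYS IN THE BAND FOR N STEPS.**  Clamp family (letter `hβ`, C ≥ 0, 0 ≤ θ < 1, 0 < τ ≤ 1), growth factor
M = 1 + 2C∕(1 − θ), initial displacement δ₀ > 0 with M^N·δ₀ ≤ τ∕2, and the forward table `tbl` of (0.20) (`…HistoryNonuniqueForward`) started at g_0 = 1∕√(1 + δ₀):
the diagonal g_k := tbl k k is POSITIVE, solves (0.20) up to N (`RGEqH N β g`), and |1∕g_i² − 1| ≤ M^i·δ₀ for every i ≤ N.  (Joint induction: inside the band the β-value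
at the prefix is at most (2C∕(1−θ))·M^kδ₀ by `beta_prefix_abs_le`, so the next chart value 1∕g_k² − β ≥ 1 − M^{k+1}δ₀ ≥ 1 − τ∕2 > 0 and `fwd_d020` applies.)
[cite: Balaban1987RG1, (0.20) p.256 with p.298] -/
theorem clampRun {β : HBeta} {C θ τ : ℝ}
    (hβ : ∀ (k : ℕ) (p : Fin (k + 1) → ℝ), β k p = C * ∑ i : Fin (k + 1), θ ^ (k - (i : ℕ)) * max (-τ) (min τ (1 - p i)))
    (hC : 0 ≤ C) (hθ0 : 0 ≤ θ) (hθ1 : θ < 1) (hτ1 : τ ≤ 1)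
    {M δ₀ : ℝ} (hM : M = 1 + 2 * C / (1 - θ)) (hδ : 0 < δ₀) {N : ℕ} (hN : M ^ N * δ₀ ≤ τ / 2)
    {tbl : ℕ → ℕ → ℝ}
    (hcs : ∀ k i, tbl (k + 1) i =
      if i ≤ k then tbl k i else 1 / Real.sqrt (1 / (tbl k k) ^ 2 - β k (fun j : Fin (k + 1) => tbl k j)))
    (h0 : tbl 0 0 = 1 / Real.sqrt (1 + δ₀)) :
    (∀ i, i ≤ N → 0 < tbl i i ∧ |1 / (tbl i i) ^ 2 - 1| ≤ M ^ i * δ₀) ∧ RGEqH N β (fun k => tbl k k) := by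
  have h1θ : 0 < 1 - θ := by linarith
  have hM1 : 1 ≤ M := by
    have : 0 ≤ 2 * C / (1 - θ) := div_nonneg (by linarith) h1θ.le
    rw [hM]; linarith
  have hmono : ∀ i, i ≤ N → M ^ i * δ₀ ≤ M ^ N * δ₀ := fun i hi =>
    mul_le_mul_of_nonneg_right (pow_le_pow_right₀ hM1 hi) hδ.le
  have hτ0 : 0 < τ := by
    have : 0 < M ^ N * δ₀ := mul_pos (pow_pos (by linarith) N) hδ
    linarith
  obtain ⟨hs0, _, hsD⟩ := start_facts hδ
  have main : ∀ k, k ≤ N →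
      (∀ i, i ≤ k → 0 < tbl i i ∧ |1 / (tbl i i) ^ 2 - 1| ≤ M ^ i * δ₀) ∧ RGEqH k β (fun k => tbl k k) := by
    intro k
    induction k with
    | zero =>
      intro _
      refine ⟨fun i hi => ?_, fun j hj => absurd hj (Nat.not_lt_zero _)⟩
      obtain rfl := Nat.le_zero.mp hi
      rw [h0, pow_zero, one_mul, hsD, abs_of_pos hδ]
      exact ⟨hs0, le_rfl⟩
    | succ k ih =>
      intro hk
      obtain ⟨hin, hrg⟩ := ih (Nat.le_of_succ_le hk)
      have hposk : ∀ i, i ≤ k → 0 < tbl i i := fun i hi => (hin i hi).1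
      have hDk : ∀ i, i ≤ k → |1 / (tbl i i) ^ 2 - 1| ≤ M ^ k * δ₀ := fun i hi =>
        (hin i hi).2.trans (mul_le_mul_of_nonneg_right (pow_le_pow_right₀ hM1 hi) hδ.le)
      have hbandk : ∀ i, i ≤ k → |1 - tbl i i| ≤ τ := fun i hi =>
        (abs_one_sub_le_of_inv_sq (hposk i hi) (by linarith)
          ((hin i hi).2.trans ((hmono i (hi.trans (Nat.le_of_succ_le hk))).trans hN))).trans (by linarith)
      have hSabs : |β k (prefixOf (fun i => tbl i i) k)| ≤ 2 * C / (1 - θ) * (M ^ k * δ₀) :=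
        beta_prefix_abs_le hβ hC hθ0 hθ1 hτ1 hposk hbandk hDk
      have hDk' := (hin k le_rfl).2
      have hnext : |(1 / (tbl k k) ^ 2 - 1) - β k (prefixOf (fun i => tbl i i) k)| ≤ M ^ (k + 1) * δ₀ :=
        calc |(1 / (tbl k k) ^ 2 - 1) - β k (prefixOf (fun i => tbl i i) k)|
            ≤ |1 / (tbl k k) ^ 2 - 1| + |β k (prefixOf (fun i => tbl i i) k)| := abs_sub _ _
          _ ≤ M ^ k * δ₀ + 2 * C / (1 - θ) * (M ^ k * δ₀) := add_le_add hDk' hSabs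
          _ = M ^ (k + 1) * δ₀ := by rw [pow_succ, hM]; ring
      have hbnd : M ^ (k + 1) * δ₀ ≤ τ / 2 := (hmono (k + 1) hk).trans hN
      have hxpos : 0 < 1 / (tbl k k) ^ 2 - β k (prefixOf (fun i => tbl i i) k) := by
        have h := (abs_le.mp (hnext.trans hbnd)).1
        linarith
      have hd := fwd_d020 hcs k hxpos
      refine ⟨fun i hi => ?_, fun j hj => ?_⟩
      · rcases Nat.lt_or_eq_of_le hi with hlt | rfl
        · exact hin i (Nat.lt_succ_iff.mp hlt)
        · refine ⟨hd.1, ?_⟩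
          have e : 1 / (tbl (k + 1) (k + 1)) ^ 2 - 1
              = (1 / (tbl k k) ^ 2 - 1) - β k (prefixOf (fun i => tbl i i) k) := by linarith [hd.2]
          rw [e]; exact hnext
      · rcases Nat.lt_or_eq_of_le (Nat.lt_succ_iff.mp hj) with hlt | rfl
        · exact hrg j hlt
        · exact hd.2
  exact main N le_rfl

/-- **ORDER REVERSAL INSIDE THE MODULI ABOVE THE EDGE — THE CONSTANT 2(1 − √θ)² OF `order_preserved_sqrt` IS SHARP.**  For every 0 < θ < 1 and every
c > 2(1 − √θ)² there are C ≥ 0, γ > 0 with Cγ³ ≤ c, moduli Λ with `FadingMemory C θ Λ`, a history-dependent β with `HistLipschitz Λ γ β`, a depth K and two runs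
g, g′ of (0.20) of length K inside ]0, γ] with g_0 < g′_0 but NOT g_j < g′_j for all j ≤ K.  (The clamp family with the constants of `constants_exist`; g′ ≡ 1;
g = the run of `clampRun`; inside the band the discrepancies D_j = 1∕g_j² − 1 obey `band_twoTerm`, and `oscillation_fin` produces j ≤ K with D_j ≤ 0, i.e. g_j ≥ 1.)
Every other hypothesis of `…Sharp.order_preserved_sqrt` holds; only the box is larger. [cite: Balaban1987RG1, (0.20) p.256 with p.298 and Thm 2 p.259 («g₀ = g₀(ε, g)»)] -/
theorem order_reversal_above_edge {θ c : ℝ} (hθ0 : 0 < θ) (hθ1 : θ < 1) (hc : 2 * (1 - Real.sqrt θ) ^ 2 < c) :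
    ∃ (C γ : ℝ) (Λ : ℕ → ℕ → ℝ) (β : HBeta) (K : ℕ) (g g' : ℕ → ℝ),
      0 ≤ C ∧ 0 < γ ∧ C * γ ^ 3 ≤ c ∧ FadingMemory C θ Λ ∧ HistLipschitz Λ γ β ∧
      RGEqH K β g ∧ RGEqH K β g' ∧ (∀ i, i ≤ K → 0 < g i ∧ g i ≤ γ) ∧ (∀ i, i ≤ K → 0 < g' i ∧ g' i ≤ γ) ∧
      g 0 < g' 0 ∧ ¬ (∀ j, j ≤ K → g j < g' j) := by
  obtain ⟨C, τ, hC0, hτ0, hτ4, hCγ, hcm⟩ := constants_exist hc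
  -- the family (def-free: a `let` with its unfolding letter)
  let βt : HBeta := fun k p => C * ∑ i : Fin (k + 1), θ ^ (k - (i : ℕ)) * max (-τ) (min τ (1 - p i))
  have hβ : ∀ (k : ℕ) (p : Fin (k + 1) → ℝ),
      βt k p = C * ∑ i : Fin (k + 1), θ ^ (k - (i : ℕ)) * max (-τ) (min τ (1 - p i)) := fun _ _ => rfl
  -- the depth
  set p : ℝ := 1 + θ - C * ((1 - τ) ^ 2 / (2 + τ)) with hp
  have hsq : Real.sqrt θ ^ 2 = θ := Real.sq_sqrt hθ0.le
  have hp2 : p < 2 * Real.sqrt θ := by rw [hp]; nlinarith [hcm, hsq]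
  obtain ⟨n, hn1, hn⟩ := depth_exists (p ^ 2 / (θ - p ^ 2 / 4) + 1)
  -- growth factor, initial displacement, start
  have h1θ : 0 < 1 - θ := by linarith
  set M : ℝ := 1 + 2 * C / (1 - θ) with hM
  have hMpos : 0 < M := by
    have : 0 ≤ 2 * C / (1 - θ) := div_nonneg (by linarith) h1θ.le
    rw [hM]; linarith
  have hMN : 0 < M ^ (n + 1) := pow_pos hMpos _
  set δ₀ : ℝ := τ / (2 * M ^ (n + 1)) with hδ₀
  have hδ : 0 < δ₀ := by rw [hδ₀]; positivity
  have hN : M ^ (n + 1) * δ₀ ≤ τ / 2 := by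
    rw [hδ₀, mul_div_assoc', mul_comm (M ^ (n + 1)) τ, mul_div_mul_right _ _ hMN.ne']
  -- the forward table of (0.20) started at 1/√(1+δ₀)
  let tbl : ℕ → ℕ → ℝ := fun k => Nat.rec (motive := fun _ => ℕ → ℝ) (fun _ => 1 / Real.sqrt (1 + δ₀))
      (fun k t i => if i ≤ k then t i else 1 / Real.sqrt (1 / (t k) ^ 2 - βt k (fun j : Fin (k + 1) => t j))) k
  have hcs : ∀ (k i : ℕ), tbl (k + 1) i =
      if i ≤ k then tbl k i else 1 / Real.sqrt (1 / (tbl k k) ^ 2 - βt k (fun j : Fin (k + 1) => tbl k j)) :=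
    fun _ _ => rfl
  have h0 : tbl 0 0 = 1 / Real.sqrt (1 + δ₀) := rfl
  obtain ⟨hin, hrg⟩ := clampRun hβ hC0.le hθ0.le hθ1 (by linarith) hM hδ hN hcs h0
  have hpos : ∀ i, i ≤ n + 1 → 0 < tbl i i := fun i hi => (hin i hi).1
  have hM1 : 1 ≤ M := by
    have : 0 ≤ 2 * C / (1 - θ) := div_nonneg (by linarith) h1θ.le
    rw [hM]; linarith
  have hband : ∀ i, i ≤ n + 1 → |1 - tbl i i| ≤ τ := fun i hi =>
    (abs_one_sub_le_of_inv_sq (hpos i hi) (by linarith)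
      (((hin i hi).2.trans (mul_le_mul_of_nonneg_right (pow_le_pow_right₀ hM1 hi) hδ.le)).trans hN)).trans
      (by linarith)
  obtain ⟨hs0, hs1, hsD⟩ := start_facts hδ
  refine ⟨C, 1 + τ, fun k i => C * θ ^ (k - i), βt, n + 1, fun k => tbl k k, fun _ => 1, hC0.le, by linarith,
    hCγ, fadingMemory_clamp hC0.le hθ0.le, histLipschitz_clamp hβ hC0.le hθ0.le _, hrg, rgEqH_const hβ hτ0.le _,
    fun i hi => ⟨hpos i hi, by linarith [(abs_le.mp (hband i hi)).1]⟩, fun i _ => ⟨one_pos, by linarith⟩, ?_, ?_⟩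
  · show tbl 0 0 < 1
    rw [h0]; exact hs1
  · intro hall
    have hD0 : 0 < 1 / (tbl 0 0) ^ 2 - 1 := by rw [h0, hsD]; exact hδ
    have hrec : ∀ k, k + 1 ≤ n → 0 ≤ 1 / (tbl (k + 1) (k + 1)) ^ 2 - 1 →
        1 / (tbl (k + 2) (k + 2)) ^ 2 - 1 ≤ p * (1 / (tbl (k + 1) (k + 1)) ^ 2 - 1) - θ * (1 / (tbl k k) ^ 2 - 1) :=
      fun k hk hDk => band_twoTerm hβ hC0.le (by linarith) hrg hpos hband (by omega) hDk
    obtain ⟨j, hj, hDj⟩ :=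
      oscillation_fin (D := fun i => 1 / (tbl i i) ^ 2 - 1) hθ0 hp2 hn1 (fun _ => hn) hrec hD0
    exact absurd (hall j hj) (not_lt.mpr (one_le_of_D_nonpos (hpos j hj) hDj))

end

end Summit.QuantumFields.BalabanUV.Beta.EriceFlowEnclosureB12AsPrintedPointwiseFadingOrderSharpWitnessEnd
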